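import Literature.Analysis.Fourier.FermionicPoissonSummation
import HarnessLib

/-!
# Fermionic Matsubara sums: the tail outside a finite frequency window is `O(β/M)` for `O(ω⁻²)` coefficients

Topic `Analysis/Fourier`; namespace `Literature.Analysis.Fourier`; companion of `FermionicPoissonSummation` (the antiperiodic image
identity for the FULL sum `(1/β)Σ_{n∈ℤ} e^{-iω_nτ}G(ω_n)`, `ω_n = (2n+1)π/β`).  Lattice regularisations (Benfatto–Giuliani–Mastropietro 2006
§2.1 (2.3)–(2.4): `M` time slices ⇒ the frequency window `n ∈ [-M, M)`) carry the TRUNCATED sum; for coefficients with `‖G(ω)‖ ≤ A/ω²`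
beyond the window (an off-site cutoff propagator: the `1/ω` part is spatially local) the difference is absolutely summable and small:

* (private) `Σ_{k<K} 1/(2(k+M)+1)² ≤ 1/(4M)` (telescoping, `M ≥ 1`) and the same for the series;
* **`norm_fermionicMatsubaraSum_sub_window_le`** — if `‖G(ω)‖ ≤ A/ω²` for `|ω| ≥ (2M+1)π/β` and the full sum is summable, then for every real `τ`
  `‖(1/β)Σ_{n∈ℤ} e^{-iω_nτ}G(ω_n) − (1/β)Σ_{n<M}(e^{-iν_nτ}G(ν_n) + e^{+iν_nτ}G(−ν_n))‖ ≤ A·β/(2π²M)`, `ν_n = (2n+1)π/β`, `n : ℕ`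
  (the window written as the `M` pairs `±(2n+1)π/β`, the shape of the tree's `sum_matsubaraIdx_freq_eq_sum_range`).

Everything is proved; no definitions, no named facts.  [cite: BenfattoGiulianiMastropietro2006, §2.1 (2.3)–(2.4)] [cite: FetterWalecka1971, Ch. 7 §25]

## Mathlib / tree search
Mathlib: `tsum_of_nat_of_neg_add_one`, `sum_add_tsum_nat_add`, `tsum_of_norm_bounded`, `summable_of_sum_range_le`, `Finset.sum_range_sub`.
Tree: `MatsubaraTruncationRemainder.sum_matsubaraIdx_one_div_sq_le` (the IN-window sum `Σᵢ 1/ωᵢ² ≤ β²/3`), `…norm_truncatedRemainder_le`; the OUT-of-window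
tail bound was absent (`rg '2 \* \(k|n\) \+ M|window' Literature/Analysis Literature/MathematicalPhysics/QuantumLattice`).
-/

noncomputable section

open Complex Filter Topology Finset
open scoped Real

namespace Literature.Analysis.Fourier

/-! ### §1 The telescoping tail `Σ_{k ≥ M} 1/(2k+1)² ≤ 1/(4M)` -/

/-- `1/(2x+1)² ≤ ¼·(1/x − 1/(x+1))` for `x > 0` (since `(2x+1)² ≥ 4x(x+1)`). [folklore] -/
private theorem one_div_odd_sq_le_quarter_sub {x : ℝ} (hx : 0 < x) :
    1 / ((2 * x + 1) ^ 2) ≤ (1 / 4) * (1 / x - 1 / (x + 1)) := by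
  rw [div_sub_div _ _ hx.ne' (by linarith), div_le_iff₀ (by positivity)]
  field_simp
  nlinarith

/-- **`Σ_{k<K} 1/(2(k+M)+1)² ≤ 1/(4M)`** for `M ≥ 1` and every `K` (telescoping). [folklore] -/
private theorem sum_range_one_div_odd_sq_shift_le {M : ℕ} (hM : 1 ≤ M) (K : ℕ) :
    ∑ k ∈ Finset.range K, 1 / ((2 * ((k : ℝ) + M) + 1) ^ 2) ≤ 1 / (4 * (M : ℝ)) := by
  have hMr : (0 : ℝ) < M := by exact_mod_cast hM
  calc ∑ k ∈ Finset.range K, 1 / ((2 * ((k : ℝ) + M) + 1) ^ 2)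
      ≤ ∑ k ∈ Finset.range K, (1 / 4) * (1 / ((k : ℝ) + M) - 1 / ((k : ℝ) + M + 1)) :=
        Finset.sum_le_sum fun k _ => one_div_odd_sq_le_quarter_sub (by positivity)
    _ = (1 / 4) * ∑ k ∈ Finset.range K, ((-(1 / (((k + 1 : ℕ) : ℝ) + M))) - (-(1 / ((k : ℝ) + M)))) := by
        rw [Finset.mul_sum]
        refine Finset.sum_congr rfl fun k _ => ?_
        push_cast; ring
    _ = (1 / 4) * (-(1 / (((K : ℕ) : ℝ) + M)) - (-(1 / (((0 : ℕ) : ℝ) + M)))) := by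
        rw [Finset.sum_range_sub (fun k : ℕ => -(1 / ((k : ℝ) + M))) K]
    _ ≤ 1 / (4 * (M : ℝ)) := by
        have h1 : 0 ≤ 1 / ((K : ℝ) + M) := by positivity
        have h2 : (1 / 4) * (1 / (M : ℝ)) = 1 / (4 * (M : ℝ)) := by field_simp
        rw [Nat.cast_zero, zero_add, ← h2]
        nlinarith [h1]

/-- Summability and the series bound: `Σ_{k ∈ ℕ} 1/(2(k+M)+1)² ≤ 1/(4M)` (`M ≥ 1`). [folklore] -/
private theorem tsum_one_div_odd_sq_shift_le {M : ℕ} (hM : 1 ≤ M) :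
    Summable (fun k : ℕ => 1 / ((2 * ((k : ℝ) + M) + 1) ^ 2)) ∧
      ∑' k : ℕ, 1 / ((2 * ((k : ℝ) + M) + 1) ^ 2) ≤ 1 / (4 * (M : ℝ)) := by
  have hnn : ∀ k : ℕ, 0 ≤ 1 / ((2 * ((k : ℝ) + M) + 1) ^ 2) := fun k => by positivity
  have hs : Summable (fun k : ℕ => 1 / ((2 * ((k : ℝ) + M) + 1) ^ 2)) :=
    summable_of_sum_range_le hnn (sum_range_one_div_odd_sq_shift_le hM)
  exact ⟨hs, hs.tsum_le_of_sum_range_le (sum_range_one_div_odd_sq_shift_le hM)⟩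

/-! ### §2 The window truncation -/

/-- `‖e^{-iωτ}‖ = 1` for real `ω, τ`. [folklore] -/
private theorem norm_cexp_neg_I_mul_mul_ofReal (ω τ : ℝ) : ‖cexp (-(I * (ω : ℂ) * τ))‖ = 1 := by
  rw [Complex.norm_exp]
  simp

/-- **FERMIONIC WINDOW TRUNCATION**: let `ω_n = (2n+1)π/β` (`β > 0`, `M ≥ 1`), `‖G(ω)‖ ≤ A/ω²` whenever `|ω| ≥ (2M+1)π/β`, and let the full
sum `Σ_{n∈ℤ} e^{-iω_nτ}G(ω_n)` be summable.  Then
`‖(1/β)Σ_{n∈ℤ} e^{-iω_nτ}G(ω_n) − (1/β)Σ_{n<M}(e^{-iν_nτ}G(ν_n) + e^{iν_nτ}G(−ν_n))‖ ≤ A·β/(2π²M)` (`ν_n = (2n+1)π/β`, `n < M`).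
[cite: BenfattoGiulianiMastropietro2006, §2.1 (2.3)–(2.4)] -/
theorem norm_fermionicMatsubaraSum_sub_window_le {G : ℝ → ℂ} {β A : ℝ} (hβ : 0 < β) (hA : 0 ≤ A) {M : ℕ} (hM : 1 ≤ M)
    (hG : ∀ ω : ℝ, (2 * M + 1) * π / β ≤ |ω| → ‖G ω‖ ≤ A / ω ^ 2) (τ : ℝ)
    (hs : Summable fun n : ℤ => cexp (-(I * (((2 * n + 1) * π / β : ℝ) : ℂ) * τ)) * G ((2 * n + 1) * π / β)) :
    ‖((1 / β : ℝ) : ℂ) * ∑' n : ℤ, cexp (-(I * (((2 * n + 1) * π / β : ℝ) : ℂ) * τ)) * G ((2 * n + 1) * π / β) -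
        ((1 / β : ℝ) : ℂ) * ∑ n ∈ Finset.range M,
          (cexp (-(I * (((2 * n + 1) * π / β : ℝ) : ℂ) * τ)) * G ((2 * n + 1) * π / β) +
            cexp (-(I * ((-((2 * n + 1) * π / β) : ℝ) : ℂ) * τ)) * G (-((2 * n + 1) * π / β)))‖ ≤
      A * β / (2 * π ^ 2 * M) := by
  set f : ℤ → ℂ := fun n => cexp (-(I * (((2 * n + 1) * π / β : ℝ) : ℂ) * τ)) * G ((2 * n + 1) * π / β) with hf
  have hMr : (0 : ℝ) < M := by exact_mod_cast hM
  -- the two half-line pieces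
  have hs1 : Summable fun n : ℕ => f n := hs.comp_injective Nat.cast_injective
  have hs2 : Summable fun n : ℕ => f (-((n : ℤ) + 1)) :=
    hs.comp_injective fun a b h => by simpa using h
  have hsplit : ∑' n : ℤ, f n = ∑' n : ℕ, f n + ∑' n : ℕ, f (-((n : ℤ) + 1)) := tsum_of_nat_of_neg_add_one hs1 hs2
  have ht1 : ∑ n ∈ Finset.range M, f n + ∑' k : ℕ, f ((k + M : ℕ) : ℤ) = ∑' n : ℕ, f n := by
    simpa using (hs1.sum_add_tsum_nat_add M)
  have ht2 : ∑ n ∈ Finset.range M, f (-((n : ℤ) + 1)) + ∑' k : ℕ, f (-(((k + M : ℕ) : ℤ) + 1)) =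
      ∑' n : ℕ, f (-((n : ℤ) + 1)) := by
    simpa using (hs2.sum_add_tsum_nat_add M)
  -- termwise bounds on the tails: `‖f(±)‖ ≤ A/((2(k+M)+1)π/β)²`
  have hωk : ∀ k : ℕ, (2 * M + 1) * π / β ≤ (2 * ((k : ℝ) + M) + 1) * π / β := fun k => by
    apply div_le_div_of_nonneg_right _ hβ.le
    have : (0 : ℝ) ≤ k := k.cast_nonneg
    nlinarith [Real.pi_pos]
  have key : ∀ x : ℝ, x ≠ 0 → A / (x * π / β) ^ 2 = A * (β / π) ^ 2 * (1 / x ^ 2) := fun x hx => by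
    have hπ : (π : ℝ) ≠ 0 := Real.pi_ne_zero
    field_simp
  have hbd1 : ∀ k : ℕ, ‖f ((k + M : ℕ) : ℤ)‖ ≤ A * (β / π) ^ 2 * (1 / ((2 * ((k : ℝ) + M) + 1) ^ 2)) := by
    intro k
    rw [hf]; dsimp only
    rw [norm_mul, norm_cexp_neg_I_mul_mul_ofReal, one_mul]
    have hcast : ((2 * (((k + M : ℕ) : ℤ) : ℝ) + 1) * π / β) = (2 * ((k : ℝ) + M) + 1) * π / β := by push_cast; ring
    have hω : (2 * M + 1) * π / β ≤ |((2 * (((k + M : ℕ) : ℤ) : ℝ) + 1) * π / β)| := by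
      rw [hcast, abs_of_nonneg (by positivity)]; exact hωk k
    refine (hG _ hω).trans (le_of_eq ?_)
    rw [hcast]; exact key _ (by positivity)
  have hbd2 : ∀ k : ℕ, ‖f (-(((k + M : ℕ) : ℤ) + 1))‖ ≤ A * (β / π) ^ 2 * (1 / ((2 * ((k : ℝ) + M) + 1) ^ 2)) := by
    intro k
    rw [hf]; dsimp only
    rw [norm_mul, norm_cexp_neg_I_mul_mul_ofReal, one_mul]
    have hcast : ((2 * ((-(((k + M : ℕ) : ℤ) + 1) : ℤ) : ℝ) + 1) * π / β) = -((2 * ((k : ℝ) + M) + 1) * π / β) := by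
      push_cast; ring
    have hω : (2 * M + 1) * π / β ≤ |((2 * ((-(((k + M : ℕ) : ℤ) + 1) : ℤ) : ℝ) + 1) * π / β)| := by
      rw [hcast, abs_neg, abs_of_nonneg (by positivity)]; exact hωk k
    refine (hG _ hω).trans (le_of_eq ?_)
    rw [hcast, neg_sq]; exact key _ (by positivity)
  obtain ⟨hsg, htsum⟩ := tsum_one_div_odd_sq_shift_le hM
  have hg : HasSum (fun k : ℕ => A * (β / π) ^ 2 * (1 / ((2 * ((k : ℝ) + M) + 1) ^ 2)))
      (A * (β / π) ^ 2 * ∑' k : ℕ, 1 / ((2 * ((k : ℝ) + M) + 1) ^ 2)) := hsg.hasSum.mul_left _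
  have hT1 : ‖∑' k : ℕ, f ((k + M : ℕ) : ℤ)‖ ≤ A * (β / π) ^ 2 * ∑' k : ℕ, 1 / ((2 * ((k : ℝ) + M) + 1) ^ 2) :=
    tsum_of_norm_bounded hg hbd1
  have hT2 : ‖∑' k : ℕ, f (-(((k + M : ℕ) : ℤ) + 1))‖ ≤ A * (β / π) ^ 2 * ∑' k : ℕ, 1 / ((2 * ((k : ℝ) + M) + 1) ^ 2) :=
    tsum_of_norm_bounded hg hbd2
  -- the window terms are `f n` and `f (-(n+1))` at `n : ℕ`
  have harg1 : ∀ n : ℕ, ((2 * ((n : ℤ) : ℝ) + 1) * π / β) = (2 * (n : ℝ) + 1) * π / β := fun n => by push_cast; ring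
  have harg2 : ∀ n : ℕ, ((2 * ((-((n : ℤ) + 1) : ℤ) : ℝ) + 1) * π / β) = -((2 * (n : ℝ) + 1) * π / β) := fun n => by
    push_cast; ring
  have hwin : ∑ n ∈ Finset.range M,
      (cexp (-(I * (((2 * n + 1) * π / β : ℝ) : ℂ) * τ)) * G ((2 * n + 1) * π / β) +
        cexp (-(I * ((-((2 * n + 1) * π / β) : ℝ) : ℂ) * τ)) * G (-((2 * n + 1) * π / β))) =
      ∑ n ∈ Finset.range M, (f n + f (-((n : ℤ) + 1))) := by
    refine Finset.sum_congr rfl fun n _ => ?_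
    rw [hf]; dsimp only; rw [harg1 n, harg2 n]
  have hdiff : ((1 / β : ℝ) : ℂ) * ∑' n : ℤ, f n - ((1 / β : ℝ) : ℂ) * ∑ n ∈ Finset.range M, (f n + f (-((n : ℤ) + 1))) =
      ((1 / β : ℝ) : ℂ) * (∑' k : ℕ, f ((k + M : ℕ) : ℤ) + ∑' k : ℕ, f (-(((k + M : ℕ) : ℤ) + 1))) := by
    rw [hsplit, ← ht1, ← ht2, Finset.sum_add_distrib]; ring
  rw [hwin, hdiff, norm_mul, Complex.norm_real, Real.norm_eq_abs, abs_of_pos (by positivity)]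
  have hπ : (0 : ℝ) < π := Real.pi_pos
  calc 1 / β * ‖∑' k : ℕ, f ((k + M : ℕ) : ℤ) + ∑' k : ℕ, f (-(((k + M : ℕ) : ℤ) + 1))‖
      ≤ 1 / β * (A * (β / π) ^ 2 * (1 / (4 * (M : ℝ))) + A * (β / π) ^ 2 * (1 / (4 * (M : ℝ)))) := by
        refine mul_le_mul_of_nonneg_left ((norm_add_le _ _).trans (add_le_add ?_ ?_)) (by positivity)
        · exact hT1.trans (mul_le_mul_of_nonneg_left htsum (by positivity))
        · exact hT2.trans (mul_le_mul_of_nonneg_left htsum (by positivity))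
    _ = A * β / (2 * π ^ 2 * M) := by field_simp; ring

end Literature.Analysis.Fourier

end
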